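import Mathlib
import Summits.Ventures.HodgeRepro.Tier4.Common.LocalCoordinatesConj
import Summits.Ventures.HodgeRepro.Tier4.Line4.D3Coeff
import Summits.Ventures.HodgeRepro.Tier4.Line4.D3CoeffConj
import Summits.Ventures.HodgeRepro.Tier4.Line4.D3CoeffDelta
import Summits.Ventures.HodgeRepro.Tier4.Line4.DefiniteCoeff

/-!
# Tier4/Line4/DetTwist — the determinant of the `T′`-adapted local block (`|det| = 1`, torus law `u₀ u₁`) and its
weight-`(c, c)` twist `detTwist c := wtMono c ∘ det ∘ locMat'` — the character factor that frees the `w₀`-weights of the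
archimedean witness (the `w₀`-factors themselves: `D3CoeffGeneral`)

Blind re-derivation cell `pub-hodge-repro`, Tier 4 (README §9–§10), seat t4-L1-p5 (prover, gen 5; C-L4-DEFCOEFF
S15129 / S15149, the `w₀`-half, part 1 of 2 — part 2 = `D3CoeffGeneral`).  Target tree path
`lean/Summits/Ventures/HodgeRepro/Tier4/Line4/DetTwist.lean`.  On
typer-2's `Common/LocalCoordinatesConj` (p700125: `locMat'`, `locMat'_mul`, `locMat'_mul_J_mul_star`), the seat's
`D3Coeff` (p699431: `locEntry_off_diag_of_mem_torusT`), `D3CoeffConj` (p700675: `D3coeff'`, its laws and the unitary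
torus weights), `D3CoeffDelta` (p702993: `D3coeff''`) and `DefiniteCoeff` (p703816: `wtMono`, `wtMono_unit_mul`,
`locEntry'_mul_of_mem_localTorusAt'_ne`); no printed input.

WHY.  Display (7a) of LINE L4 (v0.34 L1145) pins the `w₀`-weights of the archimedean witness only through
`_he' : eP′ w₀ − eM′ w₀ = ±(eP w₀ − eM w₀)` with `_he : eP w₀ − eM w₀ = ±3` — i.e. `(eP′ w₀, eM′ w₀) = (m + 3, m)` or
`(p, p + 3)` for a FREE integer `m` resp. `p`; `D3coeff'` (weights `(3, 0)`) and `D3coeff''` (`(0, 3)`) are the cases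
`m = 0` resp. `p = 0`.  The missing freedom is a CHARACTER of the local group: on the `w₀`-block
`det(locMat' x) ∈ U(1)` (`|det| = 1` from the unitary relation `M J′ Mᴴ = J′`, `det J′ = (a 1)_w (−a 3)_w ≠ 0`), and
`det(locMat'(κ x)) = u₀(κ) u₁(κ) det(locMat' x)` on the torus, so **`detTwist c x := wtMono c (det (locMat' x))`** has
`T′_w`-weight `(−c, −c)` and modulus `1`; the general `w₀`-factors `D3coeff' · detTwist m` (weights `(m + 3, m)`) and
`D3coeff'' · detTwist p` (weights `(p, p + 3)`) are assembled in `D3CoeffGeneral`.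

WHAT IS PROVED (kernel, no print).
* `cj_mul_inv_mul_of_laws` — laws multiply: if `cj f` and `cj g` are `(−p₁, −m₁)`- resp. `(−p₂, −m₂)`-equivariant under
  `κ⁻¹ ·` with unit weights `u₀ u₁`, then `cj (f · g)` is `(−(p₁ + p₂), −(m₁ + m₂))`-equivariant (pure algebra).
* `det_locMat'_mul`, `det_locMat'_of_mem_torusT'` (`= u₀ u₁` on `T′`), `det_locMat'_torus'_mul` / `det_locMat'_mul_torus'`,
  **`norm_det_locMat'_eq_one`** (`|det| = 1` when `(a 1)_w ≠ 0`, `(−a 3)_w ≠ 0`), `continuous_det_locMat'`,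
  `det_locMat'_mul_of_mem_localTorusAt'_ne` (the other places act trivially).
* `detTwist_one`, `continuous_detTwist`, `norm_detTwist_le_one`, `detTwist_torus'_mul` / `detTwist_mul_torus'`
  (weight `(−c, −c)` on both sides), **`cj_detTwist_inv_mul`** (the `equiv` shape with `(p, m) = (c, c)`),
  `detTwist_mul_of_mem_localTorusAt'_ne`.

NOT here: the `w₀`-factors `d3Gen` / `d3Gen'` and their `equiv` laws (`D3CoeffGeneral`); the `arch_ne` matching for a
twisted factor, `G_∞`-integrability and operator Schur (print, displayed).  Nothing here says anything about the status of the Hodge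
conjecture for CM abelian varieties, which is NOT proved (HC_CM is NOT proved by anyone in this repository).
-/

set_option autoImplicit false

noncomputable section

namespace Summit.Ventures.HodgeRepro.Tier4.Line4

open Summit.Ventures.HodgeRepro.Tier4.Common Summit.Ventures.HodgeRepro.Tier4.Line1 NumberField Matrix

open scoped ComplexConjugate

section Laws

/-- **laws multiply**: two conjugate-equivariance laws with unit weights `u₀ u₁` (`≠ 0`) and weights `(−p₁, −m₁)`,
`(−p₂, −m₂)` give the law of the product with weights `(−(p₁ + p₂), −(m₁ + m₂))`. -/
theorem cj_mul_inv_mul_of_laws {G : Type} [Group G] {f g : G → ℂ} {u₀ u₁ : ℂ} (hu₀ : u₀ ≠ 0) (hu₁ : u₁ ≠ 0)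
    {p₁ m₁ p₂ m₂ : ℤ} {κ y : G}
    (hf : RTF.cj f (κ⁻¹ * y) = u₀ ^ (-p₁) * u₁ ^ (-m₁) * RTF.cj f y)
    (hg : RTF.cj g (κ⁻¹ * y) = u₀ ^ (-p₂) * u₁ ^ (-m₂) * RTF.cj g y) :
    RTF.cj (f * g) (κ⁻¹ * y) = u₀ ^ (-(p₁ + p₂)) * u₁ ^ (-(m₁ + m₂)) * RTF.cj (f * g) y := by
  simp only [RTF.cj, Pi.mul_apply, map_mul] at hf hg ⊢
  rw [hf, hg, neg_add, neg_add, zpow_add₀ hu₀, zpow_add₀ hu₁]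
  ring

end Laws

section Det

variable {k : Type} [Field k] [NumberField k] (q : QuadData k) (a : Fin 4 → k)
  (g g' : Matrix (Fin 4) (Fin 4) k) (hgg' : g * g' = 1) (hg'g : g' * g = 1)
  (hgΩ : g * (PlaneData.mixedRow q (a 0) (a 2)).Ω = (PlaneData.mixedRow q (a 0) (a 2)).Ω * g)
  (lam : k) (hlam : lam ≠ 0)
  (hiso : g * (PlaneData.mixedRow q (a 1) (a 3)).B * gᵀ = lam • (PlaneData.mixedRow q (a 0) (a 2)).B)
  (w : InfinitePlace k)

/-- `det (locMat' (x y)) = det (locMat' x) · det (locMat' y)` at a real CM place. -/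
theorem det_locMat'_mul (hw : w.IsReal) (hcm : IsCMAt q w)
    (x y : GA ((PlaneData.mixedRow q (a 0) (a 2)).withTransportedTorus g g' hgg' hg'g hgΩ)) :
    (locMat' q a g g' hgg' hg'g hgΩ lam hiso w (x * y)).det =
      (locMat' q a g g' hgg' hg'g hgΩ lam hiso w x).det * (locMat' q a g g' hgg' hg'g hgΩ lam hiso w y).det := by
  rw [locMat'_mul q a g g' hgg' hg'g hgΩ lam hiso w hw hcm, Matrix.det_mul]

include hlam in
/-- **on `T′` the determinant is the product of the two weights**: `det (locMat' κ) = u₀(κ) · u₁(κ)` (the torus block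
is diagonal in the `T′`-adapted coordinates). -/
theorem det_locMat'_of_mem_torusT' (ha1 : a 1 ≠ 0) (ha3 : a 3 ≠ 0)
    {κ : GA ((PlaneData.mixedRow q (a 0) (a 2)).withTransportedTorus g g' hgg' hg'g hgΩ)}
    (hκ : κ ∈ torusT' ((PlaneData.mixedRow q (a 0) (a 2)).withTransportedTorus g g' hgg' hg'g hgΩ)) :
    (locMat' q a g g' hgg' hg'g hgΩ lam hiso w κ).det =
      weightAt' ((PlaneData.mixedRow q (a 0) (a 2)).withTransportedTorus g g' hgg' hg'g hgΩ) q w g g' 0 κ *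
        weightAt' ((PlaneData.mixedRow q (a 0) (a 2)).withTransportedTorus g g' hgg' hg'g hgΩ) q w g g' 1 κ := by
  have hoff := locEntry_off_diag_of_mem_torusT q (a 1) (a 3) (-1) w ha1 ha3 (by norm_num) _
    (conjTo_mem_torusT_of_mem_torusT' q a g g' hgg' hg'g hgΩ lam hlam hiso hκ)
  rw [Matrix.det_fin_two, locMat'_apply, locMat'_apply, locMat'_apply, locMat'_apply,
    locEntry'_diag_eq_weightAt', locEntry'_diag_eq_weightAt']
  unfold locEntry'
  rw [hoff.1, hoff.2, mul_zero, sub_zero]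

include hlam in
/-- **`det (locMat' (κ x)) = u₀(κ) u₁(κ) · det (locMat' x)`** for `κ ∈ T′(𝔸)`. -/
theorem det_locMat'_torus'_mul (hw : w.IsReal) (hcm : IsCMAt q w) (ha1 : a 1 ≠ 0) (ha3 : a 3 ≠ 0)
    (x κ : GA ((PlaneData.mixedRow q (a 0) (a 2)).withTransportedTorus g g' hgg' hg'g hgΩ))
    (hκ : κ ∈ torusT' ((PlaneData.mixedRow q (a 0) (a 2)).withTransportedTorus g g' hgg' hg'g hgΩ)) :
    (locMat' q a g g' hgg' hg'g hgΩ lam hiso w (κ * x)).det =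
      weightAt' ((PlaneData.mixedRow q (a 0) (a 2)).withTransportedTorus g g' hgg' hg'g hgΩ) q w g g' 0 κ *
        weightAt' ((PlaneData.mixedRow q (a 0) (a 2)).withTransportedTorus g g' hgg' hg'g hgΩ) q w g g' 1 κ *
        (locMat' q a g g' hgg' hg'g hgΩ lam hiso w x).det := by
  rw [det_locMat'_mul q a g g' hgg' hg'g hgΩ lam hiso w hw hcm,
    det_locMat'_of_mem_torusT' q a g g' hgg' hg'g hgΩ lam hlam hiso w ha1 ha3 hκ]

include hlam in
/-- **`det (locMat' (x κ)) = u₀(κ) u₁(κ) · det (locMat' x)`** for `κ ∈ T′(𝔸)`. -/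
theorem det_locMat'_mul_torus' (hw : w.IsReal) (hcm : IsCMAt q w) (ha1 : a 1 ≠ 0) (ha3 : a 3 ≠ 0)
    (x κ : GA ((PlaneData.mixedRow q (a 0) (a 2)).withTransportedTorus g g' hgg' hg'g hgΩ))
    (hκ : κ ∈ torusT' ((PlaneData.mixedRow q (a 0) (a 2)).withTransportedTorus g g' hgg' hg'g hgΩ)) :
    (locMat' q a g g' hgg' hg'g hgΩ lam hiso w (x * κ)).det =
      weightAt' ((PlaneData.mixedRow q (a 0) (a 2)).withTransportedTorus g g' hgg' hg'g hgΩ) q w g g' 0 κ *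
        weightAt' ((PlaneData.mixedRow q (a 0) (a 2)).withTransportedTorus g g' hgg' hg'g hgΩ) q w g g' 1 κ *
        (locMat' q a g g' hgg' hg'g hgΩ lam hiso w x).det := by
  rw [det_locMat'_mul q a g g' hgg' hg'g hgΩ lam hiso w hw hcm,
    det_locMat'_of_mem_torusT' q a g g' hgg' hg'g hgΩ lam hlam hiso w ha1 ha3 hκ, mul_comm]

/-- **`|det (locMat' x)| = 1`** at a real CM place with `(a 1)_w ≠ 0`, `(−a 3)_w ≠ 0` (take determinants in the unitary
relation `M J′ Mᴴ = J′`, `det J′ = (a 1)_w (−a 3)_w`). -/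
theorem norm_det_locMat'_eq_one (hw : w.IsReal) (hcm : IsCMAt q w)
    (hA : adToC w (algebraMap k (Ad k) (a 1)) ≠ 0) (hB : adToC w (algebraMap k (Ad k) (-1 * a 3)) ≠ 0)
    (x : GA ((PlaneData.mixedRow q (a 0) (a 2)).withTransportedTorus g g' hgg' hg'g hgΩ)) :
    ‖(locMat' q a g g' hgg' hg'g hgΩ lam hiso w x).det‖ = 1 := by
  have h := congrArg Matrix.det (locMat'_mul_J_mul_star q a g g' hgg' hg'g hgΩ lam hiso w hw hcm x)
  rw [Matrix.det_mul, Matrix.det_mul, Matrix.det_conjTranspose] at h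
  have hJ : (Jdiag (a 1) (a 3) (-1) w).det =
      adToC w (algebraMap k (Ad k) (a 1)) * adToC w (algebraMap k (Ad k) (-1 * a 3)) := by
    simp [Jdiag, Matrix.det_diagonal, Fin.prod_univ_two]
  rw [hJ] at h
  have hAB : adToC w (algebraMap k (Ad k) (a 1)) * adToC w (algebraMap k (Ad k) (-1 * a 3)) ≠ 0 := mul_ne_zero hA hB
  set D := (locMat' q a g g' hgg' hg'g hgΩ lam hiso w x).det with hD
  have h1 : D * star D = 1 := by
    have h2 : (D * star D) * (adToC w (algebraMap k (Ad k) (a 1)) * adToC w (algebraMap k (Ad k) (-1 * a 3))) =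
        1 * (adToC w (algebraMap k (Ad k) (a 1)) * adToC w (algebraMap k (Ad k) (-1 * a 3))) := by
      rw [one_mul]
      linear_combination h
    exact mul_right_cancel₀ hAB h2
  have h3 : Complex.normSq D = 1 := by
    have := Complex.mul_conj D
    rw [Complex.star_def] at h1
    rw [h1] at this
    exact_mod_cast this.symm
  rw [Complex.normSq_eq_norm_sq] at h3
  have hn : 0 ≤ ‖D‖ := norm_nonneg _
  nlinarith [hn, h3]

/-- `x ↦ det (locMat' x)` is continuous. -/
theorem continuous_det_locMat' : Continuous fun x => (locMat' q a g g' hgg' hg'g hgΩ lam hiso w x).det :=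
  (continuous_locMat' q a g g' hgg' hg'g hgΩ lam hiso w).matrix_det

include hlam in
/-- **the other places act trivially on `locMat'` at `w`**: `locMat' (κ x) = locMat' x` for `κ ∈ T′_{w′}`, `w′ ≠ w`. -/
theorem locMat'_mul_of_mem_localTorusAt'_ne (hw : w.IsReal) (hcm : IsCMAt q w) {w' : InfinitePlace k} (hne : w' ≠ w)
    {κ : GA ((PlaneData.mixedRow q (a 0) (a 2)).withTransportedTorus g g' hgg' hg'g hgΩ)}
    (hκ : κ ∈ localTorusAt' ((PlaneData.mixedRow q (a 0) (a 2)).withTransportedTorus g g' hgg' hg'g hgΩ) w')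
    (x : GA ((PlaneData.mixedRow q (a 0) (a 2)).withTransportedTorus g g' hgg' hg'g hgΩ)) :
    locMat' q a g g' hgg' hg'g hgΩ lam hiso w (κ * x) = locMat' q a g g' hgg' hg'g hgΩ lam hiso w x := by
  ext I J
  rw [locMat'_apply, locMat'_apply]
  exact locEntry'_mul_of_mem_localTorusAt'_ne q a g g' hgg' hg'g hgΩ lam hlam hiso w hw hcm hne hκ x I J

include hlam in
/-- the other places act trivially on the determinant. -/
theorem det_locMat'_mul_of_mem_localTorusAt'_ne (hw : w.IsReal) (hcm : IsCMAt q w) {w' : InfinitePlace k}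
    (hne : w' ≠ w)
    {κ : GA ((PlaneData.mixedRow q (a 0) (a 2)).withTransportedTorus g g' hgg' hg'g hgΩ)}
    (hκ : κ ∈ localTorusAt' ((PlaneData.mixedRow q (a 0) (a 2)).withTransportedTorus g g' hgg' hg'g hgΩ) w')
    (x : GA ((PlaneData.mixedRow q (a 0) (a 2)).withTransportedTorus g g' hgg' hg'g hgΩ)) :
    (locMat' q a g g' hgg' hg'g hgΩ lam hiso w (κ * x)).det = (locMat' q a g g' hgg' hg'g hgΩ lam hiso w x).det := by
  rw [locMat'_mul_of_mem_localTorusAt'_ne q a g g' hgg' hg'g hgΩ lam hlam hiso w hw hcm hne hκ x]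

/-- **the determinant twist** `detTwist c x := wtMono c (det (locMat' x))` — the `(c, c)`-weight character factor of the
`w`-block (modulus `1`). -/
def detTwist (c : ℤ) (x : GA ((PlaneData.mixedRow q (a 0) (a 2)).withTransportedTorus g g' hgg' hg'g hgΩ)) : ℂ :=
  wtMono c (locMat' q a g g' hgg' hg'g hgΩ lam hiso w x).det

/-- `detTwist c 1 = 1`. -/
theorem detTwist_one (c : ℤ) : detTwist q a g g' hgg' hg'g hgΩ lam hiso w c 1 = 1 := by
  unfold detTwist
  rw [locMat'_one, Matrix.det_one, wtMono_one]

/-- `detTwist c` is continuous. -/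
theorem continuous_detTwist (c : ℤ) : Continuous (detTwist q a g g' hgg' hg'g hgΩ lam hiso w c) :=
  (continuous_wtMono c).comp (continuous_det_locMat' q a g g' hgg' hg'g hgΩ lam hiso w)

/-- `‖detTwist c x‖ ≤ 1` (`|det| = 1`). -/
theorem norm_detTwist_le_one (hw : w.IsReal) (hcm : IsCMAt q w)
    (hA : adToC w (algebraMap k (Ad k) (a 1)) ≠ 0) (hB : adToC w (algebraMap k (Ad k) (-1 * a 3)) ≠ 0) (c : ℤ)
    (x : GA ((PlaneData.mixedRow q (a 0) (a 2)).withTransportedTorus g g' hgg' hg'g hgΩ)) :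
    ‖detTwist q a g g' hgg' hg'g hgΩ lam hiso w c x‖ ≤ 1 :=
  norm_wtMono_le_one c (norm_det_locMat'_eq_one q a g g' hgg' hg'g hgΩ lam hiso w hw hcm hA hB x).le

include hlam in
/-- **`detTwist c (κ x) = u₀(κ)^{−c} u₁(κ)^{−c} · detTwist c x`** for `κ ∈ T′(𝔸)`. -/
theorem detTwist_torus'_mul (hw : w.IsReal) (hcm : IsCMAt q w) (ha1 : a 1 ≠ 0) (ha3 : a 3 ≠ 0) (c : ℤ)
    (x κ : GA ((PlaneData.mixedRow q (a 0) (a 2)).withTransportedTorus g g' hgg' hg'g hgΩ))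
    (hκ : κ ∈ torusT' ((PlaneData.mixedRow q (a 0) (a 2)).withTransportedTorus g g' hgg' hg'g hgΩ)) :
    detTwist q a g g' hgg' hg'g hgΩ lam hiso w c (κ * x) =
      weightAt' ((PlaneData.mixedRow q (a 0) (a 2)).withTransportedTorus g g' hgg' hg'g hgΩ) q w g g' 0 κ ^ (-c) *
        weightAt' ((PlaneData.mixedRow q (a 0) (a 2)).withTransportedTorus g g' hgg' hg'g hgΩ) q w g g' 1 κ ^ (-c) *
        detTwist q a g g' hgg' hg'g hgΩ lam hiso w c x := by
  have hu0 := conj_weightAt'_of_mem_torusT' q a g g' hgg' hg'g hgΩ lam hlam hiso w hw hcm ha1 ha3 0 hκ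
  have hu1 := conj_weightAt'_of_mem_torusT' q a g g' hgg' hg'g hgΩ lam hlam hiso w hw hcm ha1 ha3 1 hκ
  have hn0 := weightAt'_ne_zero_of_mem_torusT' q a g g' hgg' hg'g hgΩ lam hlam hiso w hw hcm ha1 ha3 0 hκ
  have hn1 := weightAt'_ne_zero_of_mem_torusT' q a g g' hgg' hg'g hgΩ lam hlam hiso w hw hcm ha1 ha3 1 hκ
  have hu : conj (weightAt' ((PlaneData.mixedRow q (a 0) (a 2)).withTransportedTorus g g' hgg' hg'g hgΩ) q w g g' 0 κ *
      weightAt' ((PlaneData.mixedRow q (a 0) (a 2)).withTransportedTorus g g' hgg' hg'g hgΩ) q w g g' 1 κ) =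
      (weightAt' ((PlaneData.mixedRow q (a 0) (a 2)).withTransportedTorus g g' hgg' hg'g hgΩ) q w g g' 0 κ *
        weightAt' ((PlaneData.mixedRow q (a 0) (a 2)).withTransportedTorus g g' hgg' hg'g hgΩ) q w g g' 1 κ)⁻¹ := by
    rw [map_mul, hu0, hu1, mul_inv]
  unfold detTwist
  rw [det_locMat'_torus'_mul q a g g' hgg' hg'g hgΩ lam hlam hiso w hw hcm ha1 ha3 x κ hκ,
    wtMono_unit_mul c hu (mul_ne_zero hn0 hn1), mul_zpow]

include hlam in
/-- **`detTwist c (x κ) = u₀(κ)^{−c} u₁(κ)^{−c} · detTwist c x`** for `κ ∈ T′(𝔸)`. -/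
theorem detTwist_mul_torus' (hw : w.IsReal) (hcm : IsCMAt q w) (ha1 : a 1 ≠ 0) (ha3 : a 3 ≠ 0) (c : ℤ)
    (x κ : GA ((PlaneData.mixedRow q (a 0) (a 2)).withTransportedTorus g g' hgg' hg'g hgΩ))
    (hκ : κ ∈ torusT' ((PlaneData.mixedRow q (a 0) (a 2)).withTransportedTorus g g' hgg' hg'g hgΩ)) :
    detTwist q a g g' hgg' hg'g hgΩ lam hiso w c (x * κ) =
      weightAt' ((PlaneData.mixedRow q (a 0) (a 2)).withTransportedTorus g g' hgg' hg'g hgΩ) q w g g' 0 κ ^ (-c) *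
        weightAt' ((PlaneData.mixedRow q (a 0) (a 2)).withTransportedTorus g g' hgg' hg'g hgΩ) q w g g' 1 κ ^ (-c) *
        detTwist q a g g' hgg' hg'g hgΩ lam hiso w c x := by
  have hu0 := conj_weightAt'_of_mem_torusT' q a g g' hgg' hg'g hgΩ lam hlam hiso w hw hcm ha1 ha3 0 hκ
  have hu1 := conj_weightAt'_of_mem_torusT' q a g g' hgg' hg'g hgΩ lam hlam hiso w hw hcm ha1 ha3 1 hκ
  have hn0 := weightAt'_ne_zero_of_mem_torusT' q a g g' hgg' hg'g hgΩ lam hlam hiso w hw hcm ha1 ha3 0 hκ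
  have hn1 := weightAt'_ne_zero_of_mem_torusT' q a g g' hgg' hg'g hgΩ lam hlam hiso w hw hcm ha1 ha3 1 hκ
  have hu : conj (weightAt' ((PlaneData.mixedRow q (a 0) (a 2)).withTransportedTorus g g' hgg' hg'g hgΩ) q w g g' 0 κ *
      weightAt' ((PlaneData.mixedRow q (a 0) (a 2)).withTransportedTorus g g' hgg' hg'g hgΩ) q w g g' 1 κ) =
      (weightAt' ((PlaneData.mixedRow q (a 0) (a 2)).withTransportedTorus g g' hgg' hg'g hgΩ) q w g g' 0 κ *
        weightAt' ((PlaneData.mixedRow q (a 0) (a 2)).withTransportedTorus g g' hgg' hg'g hgΩ) q w g g' 1 κ)⁻¹ := by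
    rw [map_mul, hu0, hu1, mul_inv]
  unfold detTwist
  rw [det_locMat'_mul_torus' q a g g' hgg' hg'g hgΩ lam hlam hiso w hw hcm ha1 ha3 x κ hκ,
    wtMono_unit_mul c hu (mul_ne_zero hn0 hn1), mul_zpow]

include hlam in
/-- **the `equiv` shape for the twist**: for `κ ∈ T′_w` and every `y`,
`RTF.cj (detTwist c) (κ⁻¹ y) = u₀(κ) ^ (−c) · u₁(κ) ^ (−c) · RTF.cj (detTwist c) y`. -/
theorem cj_detTwist_inv_mul (hw : w.IsReal) (hcm : IsCMAt q w) (ha1 : a 1 ≠ 0) (ha3 : a 3 ≠ 0) (c : ℤ)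
    {κ : GA ((PlaneData.mixedRow q (a 0) (a 2)).withTransportedTorus g g' hgg' hg'g hgΩ)}
    (hκ : κ ∈ localTorusAt' ((PlaneData.mixedRow q (a 0) (a 2)).withTransportedTorus g g' hgg' hg'g hgΩ) w)
    (y : GA ((PlaneData.mixedRow q (a 0) (a 2)).withTransportedTorus g g' hgg' hg'g hgΩ)) :
    RTF.cj (detTwist q a g g' hgg' hg'g hgΩ lam hiso w c) (κ⁻¹ * y) =
      weightAt' ((PlaneData.mixedRow q (a 0) (a 2)).withTransportedTorus g g' hgg' hg'g hgΩ) q w g g' 0 κ ^ (-c) *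
        weightAt' ((PlaneData.mixedRow q (a 0) (a 2)).withTransportedTorus g g' hgg' hg'g hgΩ) q w g g' 1 κ ^ (-c) *
        RTF.cj (detTwist q a g g' hgg' hg'g hgΩ lam hiso w c) y := by
  have hκT : κ ∈ torusT' ((PlaneData.mixedRow q (a 0) (a 2)).withTransportedTorus g g' hgg' hg'g hgΩ) := hκ.1
  have hκT' : κ⁻¹ ∈ torusT' ((PlaneData.mixedRow q (a 0) (a 2)).withTransportedTorus g g' hgg' hg'g hgΩ) :=
    (torusT' _).inv_mem hκT
  have hu0 := conj_weightAt'_of_mem_torusT' q a g g' hgg' hg'g hgΩ lam hlam hiso w hw hcm ha1 ha3 0 hκT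
  have hu1 := conj_weightAt'_of_mem_torusT' q a g g' hgg' hg'g hgΩ lam hlam hiso w hw hcm ha1 ha3 1 hκT
  unfold RTF.cj
  rw [detTwist_torus'_mul q a g g' hgg' hg'g hgΩ lam hlam hiso w hw hcm ha1 ha3 c y κ⁻¹ hκT',
    weightAt'_inv_of_mem_torusT' q a g g' hgg' hg'g hgΩ lam hlam hiso w hw hcm ha1 ha3 0 hκT,
    weightAt'_inv_of_mem_torusT' q a g g' hgg' hg'g hgΩ lam hlam hiso w hw hcm ha1 ha3 1 hκT,
    _root_.inv_zpow', _root_.inv_zpow', neg_neg, map_mul, map_mul, map_zpow₀, map_zpow₀, hu0, hu1,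
    _root_.inv_zpow', _root_.inv_zpow']

include hlam in
/-- the other places act trivially on `detTwist c`. -/
theorem detTwist_mul_of_mem_localTorusAt'_ne (hw : w.IsReal) (hcm : IsCMAt q w) {w' : InfinitePlace k}
    (hne : w' ≠ w) (c : ℤ)
    {κ : GA ((PlaneData.mixedRow q (a 0) (a 2)).withTransportedTorus g g' hgg' hg'g hgΩ)}
    (hκ : κ ∈ localTorusAt' ((PlaneData.mixedRow q (a 0) (a 2)).withTransportedTorus g g' hgg' hg'g hgΩ) w')
    (x : GA ((PlaneData.mixedRow q (a 0) (a 2)).withTransportedTorus g g' hgg' hg'g hgΩ)) :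
    detTwist q a g g' hgg' hg'g hgΩ lam hiso w c (κ * x) = detTwist q a g g' hgg' hg'g hgΩ lam hiso w c x := by
  unfold detTwist
  rw [det_locMat'_mul_of_mem_localTorusAt'_ne q a g g' hgg' hg'g hgΩ lam hlam hiso w hw hcm hne hκ x]

end Det

end Summit.Ventures.HodgeRepro.Tier4.Line4

end
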